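import Summits.KontsevichZagierPeriods.KontsevichZagierPeriods.Theorems.MultiplicationThree.Negative.Pinned

/-!
# `MultiplicationThree` (stmt-KontsevichZagierPeriods-3598) — negative knowledge, part 6: calibration at `s = 1`

`multiplicationThree_at_one`: at `s = 1` the crux HOLDS, by TWO rule-(2) moves: the Kummer map
`K(u,v) = (u^{1/3}, v^{2/3})` (`[box, u^{-2/3}v^{-1/3}] ~ [box, 9/2]`, Jacobian
`(2/9)u^{-2/3}v^{-1/3}`) and the shear `M(u,v) = (3(1−√(1−u)), 3√(1−u)·v)`, a `ℚ`-semialgebraic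
bijection of the box onto the triangle with CONSTANT Jacobian `9/2` (`[box, 9/2] ~ [triangle, 1]`).
Consequence for any would-be refutation of the crux: a separating additive invariant of
`KZ.relations` must vanish on the pair at `s = 1` — it must be genuinely `s`-dependent.
(cdisprove gen 1; sorry-free, standard axioms.)
-/

noncomputable section

open MeasureTheory Set Real
open scoped BigOperators

namespace Summit.KontsevichZagierPeriods.TerasomaMultiplication.MultiplicationThreeNegative

open Literature.NumberTheory.Transcendental
open Literature.NumberTheory.Transcendental.KZ
open Literature.ModelTheory.ExponentialFields (IsSemialgebraic)
open MvPolynomial (aeval X C)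
open Summit.KontsevichZagierPeriods.KontsevichZagierPeriods.Theses.TerasomaMultiplication
  (MultiplicationThree)

/-! ## §6 Calibration: the instance `s = 1` is two rule-(2) moves

At `s = 1` the pair is `[box, u^{-2/3}v^{-1/3}] ~ [triangle, 1]` (both of value `9/2`). The Kummer
map `K(u,v) = (u^{1/3}, v^{2/3})` (Jacobian `(2/9)u^{-2/3}v^{-1/3}`) gives `[box, u^{-2/3}v^{-1/3}] ~
[box, 9/2]`, and the shear `M(u,v) = (3(1-√(1-u)), 3√(1-u)·v)` (CONSTANT Jacobian `9/2`, a
semialgebraic bijection box → triangle) gives `[box, 9/2] ~ [triangle, 1]`. Consequence for any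
would-be kill: a separating additive invariant of `KZ.relations` must vanish on the pair at `s = 1`
(and, by the same device plus Newton–Leibniz with polynomial primitives, at every `s ∈ ℕ`), i.e. it
must be genuinely `s`-dependent. -/

/-- The constant representation `[box, q]`, `q ∈ ℚ`. [folklore] -/
def constRep (q : ℚ) : IntegralRep 2 where
  domain := box
  integrand := fun _ => (q : ℝ)
  isSemialgebraic_domain := isSemialgebraic_box
  isSemialgebraicFunOn_integrand :=
    (isSemialgebraicFunOn_aeval isSemialgebraic_box (C q : MvPolynomial (Fin 2) ℚ)).congr
      fun x _ => by simp
  integrableOn := integrableOn_const (by rw [box_eq_pi, Real.volume_pi_Ioo]; simp)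

/-! ### The Kummer map `K(u,v) = (u^{1/3}, v^{2/3})` -/

/-- The Kummer map. [folklore] -/
def K (x : Fin 2 → ℝ) : Fin 2 → ℝ := ![x 0 ^ ((1:ℝ)/3), x 1 ^ ((2:ℝ)/3)]

/-- First component. [folklore] -/
@[simp] theorem K_apply_zero (x : Fin 2 → ℝ) : K x 0 = x 0 ^ ((1:ℝ)/3) := rfl

/-- Second component. [folklore] -/
@[simp] theorem K_apply_one (x : Fin 2 → ℝ) : K x 1 = x 1 ^ ((2:ℝ)/3) := rfl

/-- The diagonal entries of `DK`. [folklore] -/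
def kDiag (x : Fin 2 → ℝ) : Fin 2 → ℝ :=
  ![(1:ℝ)/3 * x 0 ^ ((1:ℝ)/3 - 1), (2:ℝ)/3 * x 1 ^ ((2:ℝ)/3 - 1)]

/-- The derivative of the Kummer map (diagonal). [folklore] -/
def K' (x : Fin 2 → ℝ) : (Fin 2 → ℝ) →L[ℝ] (Fin 2 → ℝ) :=
  LinearMap.toContinuousLinearMap (Matrix.toLin' (Matrix.diagonal (kDiag x)))

/-- `DK` applied to a vector. [folklore] -/
theorem K'_apply (x v : Fin 2 → ℝ) (i : Fin 2) : K' x v i = kDiag x i * v i := by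
  change Matrix.toLin' (Matrix.diagonal (kDiag x)) v i = _
  rw [Matrix.toLin'_apply, Matrix.mulVec_diagonal]

/-- `det DK = (1/3)u^{-2/3} · (2/3)v^{-1/3}`. [folklore] -/
theorem det_K' (x : Fin 2 → ℝ) :
    (K' x).det = ((1:ℝ)/3 * x 0 ^ ((1:ℝ)/3 - 1)) * ((2:ℝ)/3 * x 1 ^ ((2:ℝ)/3 - 1)) := by
  change LinearMap.det (Matrix.toLin' (Matrix.diagonal (kDiag x))) = _
  rw [LinearMap.det_toLin', Matrix.det_diagonal, Fin.prod_univ_two]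
  rfl

/-- The Kummer map is differentiable on the open box with derivative `K'`. [folklore] -/
theorem hasFDerivAt_K {x : Fin 2 → ℝ} (hx : x ∈ box) : HasFDerivAt K (K' x) x := by
  have h0 : HasFDerivAt (fun y : Fin 2 → ℝ => y 0)
      (ContinuousLinearMap.proj (R := ℝ) (φ := fun _ : Fin 2 => ℝ) 0) x := hasFDerivAt_apply 0 x
  have h1 : HasFDerivAt (fun y : Fin 2 → ℝ => y 1)
      (ContinuousLinearMap.proj (R := ℝ) (φ := fun _ : Fin 2 => ℝ) 1) x := hasFDerivAt_apply 1 x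
  have hx0 : x 0 ≠ 0 := (hx 0).1.ne'
  have hx1 : x 1 ≠ 0 := (hx 1).1.ne'
  rw [hasFDerivAt_pi']
  refine Fin.forall_fin_two.mpr ⟨?_, ?_⟩
  · have hf : (fun y : Fin 2 → ℝ => K y 0) = (fun t : ℝ => t ^ ((1:ℝ)/3)) ∘ fun y => y 0 :=
      funext fun y => rfl
    rw [hf]
    refine ((Real.hasDerivAt_rpow_const (Or.inl hx0)).hasFDerivAt.comp x h0).congr_fderiv
      (ContinuousLinearMap.ext fun v => ?_)
    simp [K'_apply, kDiag]
    ring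
  · have hf : (fun y : Fin 2 → ℝ => K y 1) = (fun t : ℝ => t ^ ((2:ℝ)/3)) ∘ fun y => y 1 :=
      funext fun y => rfl
    rw [hf]
    refine ((Real.hasDerivAt_rpow_const (Or.inl hx1)).hasFDerivAt.comp x h1).congr_fderiv
      (ContinuousLinearMap.ext fun v => ?_)
    simp [K'_apply, kDiag]
    ring

/-- The Kummer map is injective on the box. [folklore] -/
theorem injOn_K : InjOn K box := by
  intro x hx y hy hxy
  have e0 := congrFun hxy 0
  have e1 := congrFun hxy 1
  simp only [K_apply_zero, K_apply_one] at e0 e1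
  have h0 : x 0 = y 0 :=
    Real.rpow_left_injOn (by norm_num : ((1:ℝ)/3) ≠ 0) (hx 0).1.le (hy 0).1.le e0
  have h1 : x 1 = y 1 :=
    Real.rpow_left_injOn (by norm_num : ((2:ℝ)/3) ≠ 0) (hx 1).1.le (hy 1).1.le e1
  funext i
  fin_cases i
  · exact h0
  · exact h1

/-- The Kummer map sends the box ONTO the box. [folklore] -/
theorem image_K_box : K '' box = box := by
  ext y
  constructor
  · rintro ⟨x, hx, rfl⟩
    refine Fin.forall_fin_two.mpr ⟨?_, ?_⟩
    · exact ⟨Real.rpow_pos_of_pos (hx 0).1 _, Real.rpow_lt_one (hx 0).1.le (hx 0).2 (by norm_num)⟩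
    · exact ⟨Real.rpow_pos_of_pos (hx 1).1 _, Real.rpow_lt_one (hx 1).1.le (hx 1).2 (by norm_num)⟩
  · intro hy
    have hy0 := hy 0
    have hy1 := hy 1
    refine ⟨![y 0 ^ (3:ℝ), y 1 ^ ((3:ℝ)/2)], Fin.forall_fin_two.mpr ⟨?_, ?_⟩, ?_⟩
    · exact ⟨Real.rpow_pos_of_pos hy0.1 _, Real.rpow_lt_one hy0.1.le hy0.2 (by norm_num)⟩
    · exact ⟨Real.rpow_pos_of_pos hy1.1 _, Real.rpow_lt_one hy1.1.le hy1.2 (by norm_num)⟩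
    · funext i
      fin_cases i
      · show (y 0 ^ (3:ℝ)) ^ ((1:ℝ)/3) = y 0
        rw [← Real.rpow_mul hy0.1.le]; norm_num
      · show (y 1 ^ ((3:ℝ)/2)) ^ ((2:ℝ)/3) = y 1
        rw [← Real.rpow_mul hy1.1.le]; norm_num

/-- A single rational power of one coordinate is `ℚ`-semialgebraic on the box. [folklore] -/
theorem isSemialgebraicFunOn_coord_rpow (j : Fin 2) (e : ℚ) :
    IsSemialgebraicFunOn ℚ box (fun x : Fin 2 → ℝ => x j ^ ((e:ℚ):ℝ)) := by
  refine (isSemialgebraicFunOn_mellinIntegrand isSemialgebraic_box ![(X j : MvPolynomial (Fin 2) ℚ)]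
    ![e] 1 fun x hx k => ?_).congr fun x _ => ?_
  · fin_cases k
    simpa using (hx j).1
  · simp [mellinIntegrand]

/-- The Kummer map is a `ℚ`-semialgebraic map on the box. [folklore] -/
theorem isSemialgebraicMapOn_K : IsSemialgebraicMapOn ℚ box K := by
  refine IsSemialgebraicMapOn.of_forall isSemialgebraic_box (Fin.forall_fin_two.mpr ⟨?_, ?_⟩)
  · have h := isSemialgebraicFunOn_coord_rpow 0 (1/3)
    refine h.congr fun x _ => ?_
    simp only [K_apply_zero]
    norm_num
  · have h := isSemialgebraicFunOn_coord_rpow 1 (2/3)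
    refine h.congr fun x _ => ?_
    simp only [K_apply_one]
    norm_num

/-- `|det DK| · (9/2) = u^{-2/3} v^{-1/3}` on the box: the box integrand at `s = 1`. [folklore] -/
theorem boxFun_one_eq {x : Fin 2 → ℝ} (hx : x ∈ box) :
    boxFun 1 x = (constRep (9/2)).integrand (K x) * |(K' x).det| := by
  have hx0 : 0 < x 0 := (hx 0).1
  have hx1 : 0 < x 1 := (hx 1).1
  have hd : 0 < (K' x).det := by
    rw [det_K']
    exact mul_pos (mul_pos (by norm_num) (Real.rpow_pos_of_pos hx0 _))
      (mul_pos (by norm_num) (Real.rpow_pos_of_pos hx1 _))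
  rw [abs_of_pos hd, det_K']
  simp only [boxFun, constRep, Rat.cast_div, Rat.cast_ofNat, Rat.cast_one, sub_self,
    Real.rpow_zero, mul_one]
  have e1 : (1:ℝ)/3 - 1 = -(2:ℝ)/3 := by norm_num
  have e2 : (2:ℝ)/3 - 1 = -(1:ℝ)/3 := by norm_num
  rw [e1, e2]
  ring

/-- **Move 1 (Kummer)**: `[box, u^{-2/3}v^{-1/3}] − [box, 9/2] ∈ changeOfVariablesRel`. [cite: KontsevichZagier2001, §1.2 rule (2)] -/
theorem boxRep_one_sub_constRep_mem :
    of (boxRep 1 one_pos) - of (constRep (9/2)) ∈ changeOfVariablesRel :=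
  ⟨2, boxRep 1 one_pos, constRep (9/2), K, K', isSemialgebraicMapOn_K,
    fun _ hx => (hasFDerivAt_K hx).hasFDerivWithinAt, injOn_K, image_K_box.symm,
    fun _ hx => boxFun_one_eq hx, rfl⟩

end Summit.KontsevichZagierPeriods.TerasomaMultiplication.MultiplicationThreeNegative
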